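import Literature.Analysis.FluidPDE.ClassicalLpInteriorBounds
import Literature.Analysis.FluidPDE.ChaeAsymptoticallySelfSimilarProfileSubcritical
import Literature.Analysis.FluidPDE.LocalLerayExistence
import Literature.Analysis.FluidPDE.LocalLerayWeakStrongUniquenessHolds
import Literature.Analysis.FluidPDE.ClassicalSuitable
import Literature.Analysis.FluidPDE.SuitableWeakRescaling
import HarnessLib

/-!
# Chae 2007, Theorem 1.5 from the local Leray theory (proofs companion, part 9)

Analysis/FluidPDE proofs file (theorems only: no definitions, no named facts), ninth companion of
`Literature/Analysis/FluidPDE/ChaeAsymptoticallySelfSimilar.lean` (D. Chae, Math. Ann. 338 (2007)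
435–449 = arXiv:math/0604234, **Theorem 1.5**, the named fact
`chae2007_asymptoticallySelfSimilar_local`). The eighth companion reduced the fact to ONE input,
`h₂`: for the classical solution `v ∈ C([0,T); L^p)`, `p ≥ 3`, and every `z`, a suitable weak
solution `(u, P)` of Albritton–Barker's class in a parabolic ball `Q((T, z), ρ)`, `ρ² ≤ T`, reaching
the final time, with `u = v` a.e. there — the sentence of the printed proof (arXiv p. 8) "the
conclusion follows from Theorem 3.1" (Gustafson–Kang–Tsai's criterion for SUITABLE weak solutions
in a cylinder reaching the blow-up time). This file proves `h₂` from the global existence theorem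
of the local Leray theory, the tree's named fact `localLeraySolution_exists_of_memE2`
(Lemarié-Rieusset 2016, Thm. 14.8: weakly divergence-free `E²` data launch global local Leray
solutions), and the tree's weak–strong uniqueness theorem `local_leray_weak_strong_uniqueness_holds`
(Lemarié-Rieusset 2016, Thm. 14.7, PROVED), exactly as the tree treats Kato's and Albritton's
solutions (`LerayFarFieldRegularity.lean`, `AlbrittonKatoClassLocalLeray.lean`; Lemarié-Rieusset
2016, proof of Thm. 15.1 (C), p. 566: "`u` coincides on `(0, T*)` with a local Leray solution"):

* `isLocalLeraySolutionOn_shift_classical` — after a restart at `t₀ ∈ (0, T)`, the classical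
  solution `v(· + t₀)` is a local Leray solution on every slab `(0, S) × ℝ³`, `t₀ + S < T`, with
  datum `v(t₀)`, bounded on `[0, S] × ℝ³` (suitability of classical solutions; the uniformly local
  bounds from the interior `L^∞` bounds of `ClassicalLpInteriorBounds.lean`; the datum and the decay
  from `v ∈ C_t L^p`);
* `ae_eq_localLeray_of_localLerayExistence` — the global local Leray solution `w` from `v(t₀)`
  (fact **E**) agrees with `v(· + t₀)` a.e. on `(0, T − t₀) × ℝ³` (weak–strong uniqueness on the
  slabs below the blow-up time, `u₃ = v(· + t₀)` bounded, `u₄ = 0`);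
* `IsLocalLeraySolution.isSuitableWeakSolutionInBall` — a global local Leray solution is a suitable
  weak solution of Albritton–Barker's class in every parabolic ball inside its slab;
* `IsSuitableWeakSolutionInBall.timeShift` — time translation of that class;
* `suitableRepresentative_of_localLerayExistence` — **`h₂` from E**;
* **`chae2007_asymptoticallySelfSimilar_local_of_localLerayExistence`** — Chae's Theorem 1.5 from
  the named fact `localLeraySolution_exists_of_memE2` alone.

## References

* D. Chae, Math. Ann. 338 (2007) = arXiv:math/0604234, proof of Thm 1.5 (arXiv p. 8) [Chae2007].
* P. G. Lemarié-Rieusset, *The Navier–Stokes Problem in the 21st Century* (2016), Def. 14.1,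
  Thm. 14.7, Thm. 14.8, proof of Thm. 15.1 (C) (p. 566) [LemarieRieusset2016].
* S. Gustafson, K. Kang, T.-P. Tsai, Comm. Math. Phys. 273 (2007), Thm. 1.1 [GustafsonKangTsai2007].
* D. Albritton, T. Barker, Arch. Ration. Mech. Anal. 232 (2019), Def. 2.1 [AlbrittonBarker2019].
-/

noncomputable section

open _root_.MeasureTheory Set Function Filter Metric TopologicalSpace InnerProductSpace
open scoped NNReal ENNReal _root_.Topology RealInnerProductSpace

namespace Literature.Analysis.FluidPDE

namespace ChaeLocalLeray

/-- Local notation for physical space `ℝ³ = EuclideanSpace ℝ (Fin 3)`. -/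
local notation "ℝ³" => EuclideanSpace ℝ (Fin 3)

/-! ### Tools -/

section Tools

/-- `∫ ‖f‖ₑ² = ‖f‖_{L²}²` (natural-number exponents). [folklore] -/
theorem lintegral_enorm_pow_two_eq {α F : Type*} [MeasurableSpace α] {μ : Measure α}
    [NormedAddCommGroup F] (f : α → F) : ∫⁻ x, ‖f x‖ₑ ^ 2 ∂μ = eLpNorm f 2 μ ^ 2 := by
  have h := eLpNorm_nnreal_pow_eq_lintegral (f := f) (μ := μ) (p := (2 : ℝ≥0)) (by norm_num)
  rw [show ((2 : ℝ≥0) : ℝ) = ((2 : ℕ) : ℝ) by norm_num,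
    show ((2 : ℝ≥0) : ℝ≥0∞) = 2 by norm_num] at h
  simp_rw [ENNReal.rpow_natCast] at h
  exact h.symm

/-- **Hölder, `L² ⊂ L^p` on a set of finite measure** (`2 ≤ p`):
`∫ ‖f‖ₑ² dμ ≤ (‖f‖_{L^p(μ)} μ(univ)^{1/2-1/p})²`. [folklore] -/
theorem lintegral_enorm_sq_le {α F : Type*} [MeasurableSpace α] {μ : Measure α}
    [NormedAddCommGroup F] {f : α → F} (hf : AEStronglyMeasurable f μ) {p : ℝ≥0∞} (h2p : 2 ≤ p) :
    ∫⁻ x, ‖f x‖ₑ ^ 2 ∂μ ≤ (eLpNorm f p μ * μ univ ^ (1 / 2 - 1 / p.toReal : ℝ)) ^ 2 := by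
  rw [lintegral_enorm_pow_two_eq]
  have h := eLpNorm_le_eLpNorm_mul_rpow_measure_univ h2p hf
  rw [show (1 / (2 : ℝ≥0∞).toReal : ℝ) = 1 / 2 by norm_num] at h
  gcongr

/-- `∫ ‖f‖ₑ^{p} = ‖f‖_{L^p}^{p}` for `0 < p < ∞` (real exponent `p.toReal`). [folklore] -/
theorem lintegral_enorm_rpow_eq {α F : Type*} [MeasurableSpace α] {μ : Measure α}
    [NormedAddCommGroup F] (f : α → F) {p : ℝ≥0∞} (hp0 : p ≠ 0) (hptop : p ≠ ∞) :
    ∫⁻ x, ‖f x‖ₑ ^ p.toReal ∂μ = eLpNorm f p μ ^ p.toReal := by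
  have hr : p.toReal ≠ 0 := (ENNReal.toReal_pos hp0 hptop).ne'
  rw [eLpNorm_eq_lintegral_rpow_enorm_toReal hp0 hptop, one_div, ENNReal.rpow_inv_rpow hr]

/-- **Tails of a finite space–time integral over far cylinders**: if `Φ ≥ 0` has finite integral
on the strip `(0, S) × ℝ³`, then `∫_{(0,S) × B_R(x₀)} Φ → 0` as `|x₀| → ∞`. [folklore] -/
theorem tendsto_setLIntegral_strip_ball {S : ℝ} {Φ : ℝ × ℝ³ → ℝ≥0∞}
    (hΦ : AEMeasurable Φ (volume.restrict (Ioo 0 S ×ˢ (univ : Set ℝ³))))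
    (hfin : ∫⁻ z in Ioo 0 S ×ˢ (univ : Set ℝ³), Φ z ≠ ∞) (R : ℝ) :
    Tendsto (fun x₀ : ℝ³ => ∫⁻ z in Ioo 0 S ×ˢ ball x₀ R, Φ z) (cocompact ℝ³) (𝓝 0) := by
  set μS : Measure (ℝ × ℝ³) := volume.restrict (Ioo (0 : ℝ) S ×ˢ (univ : Set ℝ³)) with hμS
  set B : ℕ → Set (ℝ × ℝ³) := fun n => (univ : Set ℝ) ×ˢ (closedBall (0 : ℝ³) n)ᶜ with hB_def
  have hB : ∀ n, MeasurableSet (B n) := fun n =>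
    MeasurableSet.univ.prod measurableSet_closedBall.compl
  have hrw : ∀ n : ℕ, ∫⁻ z in Ioo 0 S ×ˢ (closedBall (0 : ℝ³) (n : ℝ))ᶜ, Φ z =
      ∫⁻ z, (B n).indicator Φ z ∂μS := fun n => by
    rw [lintegral_indicator (hB n), hμS, Measure.restrict_restrict (hB n)]
    congr 2
    ext z
    simp only [hB_def, mem_inter_iff, mem_prod, mem_univ, true_and, mem_compl_iff, and_true]
    tauto
  have hlim : ∀ᵐ z ∂μS, Tendsto (fun n => (B n).indicator Φ z) atTop (𝓝 0) :=
    Eventually.of_forall fun z => by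
      have hz : ∀ᶠ n : ℕ in atTop, (B n).indicator Φ z = 0 := by
        obtain ⟨n, hn⟩ := exists_nat_ge ‖z.2‖
        filter_upwards [eventually_ge_atTop n] with m hm
        refine indicator_of_notMem ?_ _
        simp only [hB_def, mem_prod, mem_univ, true_and, mem_compl_iff, mem_closedBall_zero_iff,
          not_not]
        exact hn.trans (Nat.cast_le.2 hm)
      exact tendsto_const_nhds.congr' (hz.mono fun n hn => hn.symm)
  have htails : Tendsto (fun n : ℕ => ∫⁻ z in Ioo 0 S ×ˢ (closedBall (0 : ℝ³) (n : ℝ))ᶜ, Φ z)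
      atTop (𝓝 0) := by
    have hdom := tendsto_lintegral_of_dominated_convergence' Φ (fun n => hΦ.indicator (hB n))
      (fun n => Eventually.of_forall fun z => Set.indicator_le_self _ _ z) hfin hlim
    simpa only [hrw, lintegral_zero] using hdom
  refine ENNReal.tendsto_nhds_zero.2 fun ε hε => ?_
  obtain ⟨n, hn⟩ : ∃ n : ℕ, ∫⁻ z in Ioo 0 S ×ˢ (closedBall (0 : ℝ³) (n : ℝ))ᶜ, Φ z ≤ ε := by
    obtain ⟨n, hn⟩ := ENNReal.tendsto_atTop_zero.1 htails ε hε
    exact ⟨n, hn n le_rfl⟩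
  have hmem : (closedBall (0 : ℝ³) (n + R))ᶜ ∈ cocompact ℝ³ := (isCompact_closedBall _ _).compl_mem_cocompact
  filter_upwards [hmem] with x₀ hx₀
  refine (lintegral_mono_set (Set.prod_mono Subset.rfl fun y hy => ?_)).trans hn
  simp only [mem_compl_iff, mem_closedBall_zero_iff, not_le] at hx₀ ⊢
  rw [mem_ball, dist_eq_norm] at hy
  have h1 : ‖x₀‖ ≤ ‖y‖ + ‖y - x₀‖ := by
    calc ‖x₀‖ = ‖y - (y - x₀)‖ := by rw [sub_sub_cancel]
      _ ≤ ‖y‖ + ‖y - x₀‖ := norm_sub_le _ _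
  linarith

/-- The volume of `(0, S) × B_R(x₀)` does not depend on the centre. [folklore] -/
theorem volume_Ioo_prod_ball' (S R : ℝ) (x₀ : ℝ³) :
    volume (Ioo (0 : ℝ) S ×ˢ ball x₀ R) = volume (Ioo (0 : ℝ) S) * volume (ball (0 : ℝ³) R) := by
  rw [show (volume : Measure (ℝ × ℝ³)) = (volume : Measure ℝ).prod (volume : Measure ℝ³) from rfl,
    Measure.prod_prod, Measure.addHaar_ball_center]

/-- `|L|²_F ≤ 3 ‖L‖²` on `ℝ³` (three columns, each of norm at most `‖L‖`). [folklore] -/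
theorem frobeniusNormSq_le_three {F : Type*} [NormedAddCommGroup F] [InnerProductSpace ℝ F]
    [FiniteDimensional ℝ F] (L : ℝ³ →L[ℝ] F) : frobeniusNormSq L ≤ 3 * ‖L‖ ^ 2 := by
  unfold frobeniusNormSq
  calc ∑ i, ‖L (stdOrthonormalBasis ℝ ℝ³ i)‖ ^ 2
      ≤ ∑ _i : Fin (Module.finrank ℝ ℝ³), ‖L‖ ^ 2 := by
        refine Finset.sum_le_sum fun i _ => ?_
        have h := L.le_opNorm (stdOrthonormalBasis ℝ ℝ³ i)
        rw [(stdOrthonormalBasis ℝ ℝ³).orthonormal.1 i, mul_one] at h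
        exact pow_le_pow_left₀ (norm_nonneg _) h 2
    _ = 3 * ‖L‖ ^ 2 := by
        rw [Finset.sum_const, Finset.card_univ, Fintype.card_fin, finrank_euclideanSpace_fin]
        simp

end Tools

/-! ### The classical solution after a restart is a local Leray solution on the slabs below `T` -/

section Shift

variable {T : ℝ} {v : ℝ → ℝ³ → ℝ³} {π : ℝ → ℝ³ → ℝ}

set_option maxHeartbeats 1600000 in
/-- **After a restart, classical `C_t L^p` solutions are local Leray solutions below the blow-up
time** (Lemarié-Rieusset 2016, Def. 14.1, and the pattern of the proof of Thm. 15.1 (A), p. 565,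
for Kato's solutions; here for `p ≥ 3`). Let `(v, π)` be a classical solution of the unforced
Navier–Stokes system (`ν = 1`) on `ℝ³ × (0, T)` with `v ∈ C([0,T); L^p)`, `3 ≤ p < ∞`, `t₀ ∈ (0, T)`
and `0 < S` with `t₀ + S < T`. Then `(v(· + t₀), π(· + t₀))` is a local Leray solution on the slab
`(0, S) × ℝ³` with datum `v(t₀)` (`IsLocalLeraySolutionOn S 1 (v t₀)`), and `v(· + t₀)` is bounded
on `[0, S] × ℝ³`. Clauses: suitability since classical solutions are suitable
(`isSuitableWeakSolutionOn_of_contDiffOn`); the uniformly local energy and gradient bounds from the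
interior `L^∞` bounds of `v`, `∇v` (`ClassicalLpBounds.classical_interior_bounds`); the datum from
`v ∈ C_t L^p` and Hölder on compacts; the decay from `v ∈ L^∞((t₀, t₀+S); L^p)`, Tonelli and Hölder.
[cite: LemarieRieusset2016, Def. 14.1 and Thm. 15.1 (A) (proof p. 565); Kato1984, Thm. 1] -/
theorem isLocalLeraySolutionOn_shift_classical (hv : IsClassicalNSSolutionOn (Ioo 0 T) 1 0 v π)
    {p : ℝ≥0} (hp : 3 ≤ p) (hvc : ContinuousInLpOn (Ico 0 T) p v) {t₀ : ℝ} (ht₀ : t₀ ∈ Ioo 0 T)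
    {S : ℝ} (hS : 0 < S) (hSt : t₀ + S < T) :
    IsLocalLeraySolutionOn S 1 (v t₀) (fun t => v (t + t₀)) (fun t => π (t + t₀)) ∧
      ∃ M : ℝ, ∀ t ∈ Icc 0 S, ∀ x, ‖v (t + t₀) x‖ ≤ M := by
  set P : ℝ≥0∞ := (p : ℝ≥0∞) with hPdef
  have h3P : (3 : ℝ≥0∞) ≤ P := by rw [hPdef]; exact_mod_cast hp
  have h2P : (2 : ℝ≥0∞) ≤ P := le_trans (by norm_num) h3P
  have hP0 : P ≠ 0 := (lt_of_lt_of_le (by norm_num) h2P).ne'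
  have hPtop : P ≠ ⊤ := ENNReal.coe_ne_top
  have hr0 : 0 < P.toReal := ENNReal.toReal_pos hP0 hPtop
  have hr2 : 2 ≤ P.toReal := by
    have := (ENNReal.toReal_le_toReal (by norm_num) hPtop).2 h2P
    simpa using this
  -- the translated classical solution
  set O : Set ℝ := Ioo (-t₀) (T - t₀) with hO_def
  set v' : ℝ → ℝ³ → ℝ³ := fun t => v (t + t₀) with hv'_def
  set π' : ℝ → ℝ³ → ℝ := fun t => π (t + t₀) with hπ'_def
  have hvcl : IsClassicalNSSolutionOn O 1 0 v' π' := by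
    have h' := hv.comp_add_right t₀
    have hset : (fun t => t + t₀) ⁻¹' Ioo 0 T = O := by
      ext t
      simp only [mem_preimage, mem_Ioo, hO_def]
      constructor
      · rintro ⟨h1, h2⟩; exact ⟨by linarith, by linarith⟩
      · rintro ⟨h1, h2⟩; exact ⟨by linarith, by linarith⟩
    rw [hset] at h'
    have hf : (fun t : ℝ => (0 : ℝ → ℝ³ → ℝ³) (t + t₀)) = 0 := by funext t; rfl
    rw [hf] at h'
    exact h'
  have hvcont : ContinuousOn (uncurry v') (O ×ˢ univ) := hvcl.smooth_velocity.continuousOn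
  have hπcont : ContinuousOn (uncurry π') (O ×ˢ univ) := hvcl.smooth_pressure.continuousOn
  have hQ : ((slab ℝ³ (Ioo 0 S) isOpen_Ioo : Opens (ℝ × ℝ³)) : Set (ℝ × ℝ³)) ⊆ O ×ˢ univ := by
    intro z hz
    have hz1 := mem_slab.1 hz
    exact ⟨⟨by linarith [hz1.1, ht₀.1], by linarith [hz1.2]⟩, mem_univ _⟩
  have hIccO : Icc (0 : ℝ) S ⊆ O := fun t ht => ⟨by linarith [ht.1, ht₀.1], by linarith [ht.2]⟩
  -- ### the interior bounds of `v` on `[t₀, t₀ + S]`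
  obtain ⟨Mb, L, hbd⟩ := ClassicalLpBounds.classical_interior_bounds hv hp hvc ht₀.1
    (by linarith : t₀ ≤ t₀ + S) hSt
  have hvM : ∀ t ∈ Icc 0 S, ∀ x, ‖v' t x‖ ≤ Mb := fun t ht x =>
    (hbd (t + t₀) ⟨by linarith [ht.1], by linarith [ht.2]⟩ x).1
  have hvL : ∀ t ∈ Icc 0 S, ∀ x, ‖fderiv ℝ (v' t) x‖ ≤ L := fun t ht x =>
    (hbd (t + t₀) ⟨by linarith [ht.1], by linarith [ht.2]⟩ x).2
  have hMb0 : 0 ≤ Mb := (norm_nonneg _).trans (hvM 0 ⟨le_rfl, hS.le⟩ 0)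
  -- the `L^p` bound of the slices on `[t₀, t₀ + S]`
  have hK : Icc t₀ (t₀ + S) ⊆ Ico 0 T := fun t ht => ⟨by linarith [ht.1, ht₀.1], by linarith [ht.2]⟩
  obtain ⟨A, hA⟩ := ContinuousInLpOn.exists_forall_eLpNorm_le hvc (le_trans (by norm_num) h2P)
    isCompact_Icc hK
  have hLpS : ∀ t ∈ Ioo 0 S, eLpNorm (v' t) P volume ≤ (A : ℝ≥0∞) := fun t ht =>
    hA (t + t₀) ⟨by linarith [ht.1], by linarith [ht.2]⟩
  refine ⟨⟨?_, ?_, ?_, ?_, ?_, ?_, ?_⟩, Mb, hvM⟩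
  · -- (1)+(4) suitability: classical solutions are suitable
    refine isSuitableWeakSolutionOn_of_contDiffOn isOpen_Ioo hQ
      (hvcl.smooth_velocity.of_le (by norm_cast)) (hvcl.smooth_pressure.of_le (by norm_cast))
      continuousOn_const (fun t ht x => ?_) hvcl.divFree
    have hm := hvcl.momentum t ht x
    rwa [timeDerivWithin_apply, derivWithin_of_isOpen isOpen_Ioo ht, ← timeDeriv_apply] at hm
  · -- `v ∈ L²((0,S) × K)`
    intro K hK'
    have hKvol : volume (Ioo (0 : ℝ) S ×ˢ K) < ∞ := by
      rw [show (volume : Measure (ℝ × ℝ³)) = (volume : Measure ℝ).prod (volume : Measure ℝ³)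
        from rfl, Measure.prod_prod]
      exact ENNReal.mul_lt_top measure_Ioo_lt_top hK'.measure_lt_top
    calc ∫⁻ z in Ioo 0 S ×ˢ K, ‖v' z.1 z.2‖ₑ ^ 2
        ≤ ∫⁻ _ in Ioo 0 S ×ˢ K, ENNReal.ofReal Mb ^ 2 := by
          refine setLIntegral_mono measurable_const fun z hz => ?_
          have h1 : ‖v' z.1 z.2‖ₑ ≤ ENNReal.ofReal Mb := by
            rw [← ofReal_norm]
            exact ENNReal.ofReal_le_ofReal (hvM z.1 ⟨hz.1.1.le, hz.1.2.le⟩ z.2)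
          gcongr
      _ < ∞ := by
          rw [setLIntegral_const]
          exact ENNReal.mul_lt_top (ENNReal.pow_lt_top ENNReal.ofReal_lt_top) hKvol
  · -- `π ∈ L^{3/2}((0,S) × K)`
    intro K hK'
    have hKc : IsCompact (Icc (0 : ℝ) S ×ˢ K) := isCompact_Icc.prod hK'
    have hKO : Icc (0 : ℝ) S ×ˢ K ⊆ O ×ˢ univ := prod_mono hIccO (subset_univ _)
    obtain ⟨Pb, hPb⟩ := hKc.exists_bound_of_continuousOn (hπcont.mono hKO)
    have hKvol : volume (Ioo (0 : ℝ) S ×ˢ K) < ∞ := by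
      rw [show (volume : Measure (ℝ × ℝ³)) = (volume : Measure ℝ).prod (volume : Measure ℝ³)
        from rfl, Measure.prod_prod]
      exact ENNReal.mul_lt_top measure_Ioo_lt_top hK'.measure_lt_top
    calc ∫⁻ z in Ioo 0 S ×ˢ K, ‖π' z.1 z.2‖ₑ ^ (3 / 2 : ℝ)
        ≤ ∫⁻ _ in Ioo 0 S ×ˢ K, ENNReal.ofReal Pb ^ (3 / 2 : ℝ) := by
          refine setLIntegral_mono measurable_const fun z hz => ?_
          refine ENNReal.rpow_le_rpow ?_ (by norm_num)
          rw [← ofReal_norm]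
          exact ENNReal.ofReal_le_ofReal (hPb z ⟨Ioo_subset_Icc_self hz.1, hz.2⟩)
      _ < ∞ := by
          rw [setLIntegral_const]
          exact ENNReal.mul_lt_top
            (ENNReal.rpow_lt_top_of_nonneg (by norm_num) ENNReal.ofReal_ne_top) hKvol
  · -- uniformly local energy
    intro R hR
    have hfin : ENNReal.ofReal Mb ^ 2 * volume (ball (0 : ℝ³) R) ≠ ∞ :=
      ENNReal.mul_ne_top (ENNReal.pow_ne_top ENNReal.ofReal_ne_top) measure_ball_lt_top.ne
    refine ⟨(ENNReal.ofReal Mb ^ 2 * volume (ball (0 : ℝ³) R)).toNNReal,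
      (ae_restrict_mem measurableSet_Ioo).mono fun t ht x₀ => ?_⟩
    rw [ENNReal.coe_toNNReal hfin]
    calc ∫⁻ x in ball x₀ R, ‖v' t x‖ₑ ^ 2 ≤ ∫⁻ _ in ball x₀ R, ENNReal.ofReal Mb ^ 2 := by
          refine setLIntegral_mono measurable_const fun x _ => ?_
          have h1 : ‖v' t x‖ₑ ≤ ENNReal.ofReal Mb := by
            rw [← ofReal_norm]
            exact ENNReal.ofReal_le_ofReal (hvM t ⟨ht.1.le, ht.2.le⟩ x)
          gcongr
      _ = ENNReal.ofReal Mb ^ 2 * volume (ball (0 : ℝ³) R) := by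
          rw [setLIntegral_const, Measure.addHaar_ball_center]
  · -- uniformly local gradient
    refine ⟨fun t x => fderiv ℝ (v' t) x,
      hasWeakSpatialGradientOn_of_contDiffOn isOpen_Ioo hQ (hvcl.smooth_velocity.of_le (by norm_cast)),
      fun R hR => ?_⟩
    have hfin : ENNReal.ofReal (3 * L ^ 2) * (volume (Ioo (0 : ℝ) S) * volume (ball (0 : ℝ³) R)) ≠ ∞ :=
      ENNReal.mul_ne_top ENNReal.ofReal_ne_top
        (ENNReal.mul_ne_top measure_Ioo_lt_top.ne measure_ball_lt_top.ne)
    refine ⟨(ENNReal.ofReal (3 * L ^ 2) * (volume (Ioo (0 : ℝ) S) * volume (ball (0 : ℝ³) R))).toNNReal,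
      fun x₀ => ?_⟩
    rw [ENNReal.coe_toNNReal hfin]
    calc ∫⁻ z in Ioo 0 S ×ˢ ball x₀ R, ENNReal.ofReal (frobeniusNormSq (fderiv ℝ (v' z.1) z.2))
        ≤ ∫⁻ _ in Ioo 0 S ×ˢ ball x₀ R, ENNReal.ofReal (3 * L ^ 2) := by
          refine setLIntegral_mono measurable_const fun z hz => ?_
          refine ENNReal.ofReal_le_ofReal ((frobeniusNormSq_le_three _).trans ?_)
          have h1 := hvL z.1 ⟨hz.1.1.le, hz.1.2.le⟩ z.2
          have h0 : 0 ≤ ‖fderiv ℝ (v' z.1) z.2‖ := norm_nonneg _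
          nlinarith
      _ = ENNReal.ofReal (3 * L ^ 2) * (volume (Ioo (0 : ℝ) S) * volume (ball (0 : ℝ³) R)) := by
          rw [setLIntegral_const, volume_Ioo_prod_ball']
  · -- the datum in `L²_loc`
    intro K hK'
    have hc : Tendsto (fun τ => eLpNorm (v τ - v t₀) P volume) (𝓝[Ico 0 T] t₀) (𝓝 0) :=
      hvc.2 t₀ ⟨ht₀.1.le, ht₀.2⟩
    have hshift : Tendsto (fun t : ℝ => t + t₀) (𝓝[>] 0) (𝓝[Ico 0 T] t₀) := by
      refine tendsto_nhdsWithin_of_tendsto_nhds_of_eventually_within _ ?_ ?_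
      · have : Tendsto (fun t : ℝ => t + t₀) (𝓝 0) (𝓝 (0 + t₀)) :=
          (continuous_id.add continuous_const).tendsto 0
        rw [zero_add] at this
        exact this.mono_left nhdsWithin_le_nhds
      · filter_upwards [Ioo_mem_nhdsGT (sub_pos.2 ht₀.2)] with t ht
        exact ⟨by linarith [ht.1, ht₀.1], by linarith [ht.2]⟩
    have hN := hc.comp hshift
    set V : ℝ≥0∞ := volume K ^ (1 / 2 - 1 / P.toReal : ℝ) with hV
    have hVtop : V ≠ ∞ := ENNReal.rpow_ne_top_of_nonneg (by
      rw [sub_nonneg]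
      exact one_div_le_one_div_of_le (by norm_num) hr2) hK'.measure_lt_top.ne
    have hmaj : Tendsto (fun t => (eLpNorm (v (t + t₀) - v t₀) P volume * V) ^ 2)
        (𝓝[>] 0) (𝓝 0) := by
      have h1 := ENNReal.Tendsto.mul_const hN (Or.inr hVtop)
      rw [zero_mul] at h1
      have h2 := ((ENNReal.continuous_pow 2).tendsto 0).comp h1
      rw [zero_pow two_ne_zero] at h2
      exact h2
    have hev : ∀ᶠ t in 𝓝[>] (0 : ℝ), ∫⁻ x in K, ‖v' t x - v t₀ x‖ₑ ^ 2 ≤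
        (eLpNorm (v (t + t₀) - v t₀) P volume * V) ^ 2 := by
      filter_upwards [Ioo_mem_nhdsGT (sub_pos.2 ht₀.2)] with t ht
      have htt : t + t₀ ∈ Ico 0 T := ⟨by linarith [ht.1, ht₀.1], by linarith [ht.2]⟩
      have hm : AEStronglyMeasurable (v (t + t₀) - v t₀) (volume.restrict K) :=
        ((hvc.1 _ htt).sub (hvc.1 t₀ ⟨ht₀.1.le, ht₀.2⟩)).1.restrict
      calc ∫⁻ x in K, ‖v' t x - v t₀ x‖ₑ ^ 2 = ∫⁻ x in K, ‖(v (t + t₀) - v t₀) x‖ₑ ^ 2 := by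
            refine lintegral_congr fun x => ?_
            rfl
        _ ≤ (eLpNorm (v (t + t₀) - v t₀) P (volume.restrict K) *
              (volume.restrict K) univ ^ (1 / 2 - 1 / P.toReal : ℝ)) ^ 2 :=
            lintegral_enorm_sq_le hm h2P
        _ ≤ (eLpNorm (v (t + t₀) - v t₀) P volume * V) ^ 2 := by
            rw [Measure.restrict_apply_univ]
            gcongr
            exact Measure.restrict_le_self
    exact tendsto_of_tendsto_of_tendsto_of_le_of_le' tendsto_const_nhds hmaj
      (Eventually.of_forall fun _ => bot_le) hev
  · -- decay at spatial infinity
    intro R hR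
    have hstrip : Ioo (0 : ℝ) S ×ˢ (univ : Set ℝ³) ⊆ O ×ˢ univ :=
      prod_mono (fun t ht => hIccO ⟨ht.1.le, ht.2.le⟩) Subset.rfl
    have hvmeas : AEStronglyMeasurable (uncurry v') (volume.restrict (Ioo (0 : ℝ) S ×ˢ (univ : Set ℝ³))) :=
      (hvcont.mono hstrip).aestronglyMeasurable (measurableSet_Ioo.prod MeasurableSet.univ)
    -- Step 1: `∫₀ˢ ∫ |v|^p < ∞`
    have hfin : ∫⁻ z in Ioo 0 S ×ˢ (univ : Set ℝ³), ‖v' z.1 z.2‖ₑ ^ P.toReal ≠ ∞ := by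
      refine ne_of_lt ?_
      rw [volume_restrict_prod_univ_eq_prod]
      calc ∫⁻ z, ‖v' z.1 z.2‖ₑ ^ P.toReal ∂((volume.restrict (Ioo 0 S)).prod volume)
          ≤ ∫⁻ t in Ioo 0 S, ∫⁻ x, ‖v' t x‖ₑ ^ P.toReal :=
            lintegral_prod_le (μ := volume.restrict (Ioo 0 S)) (ν := (volume : Measure ℝ³))
              (fun z : ℝ × ℝ³ => ‖v' z.1 z.2‖ₑ ^ P.toReal)
        _ ≤ ∫⁻ _ in Ioo 0 S, (A : ℝ≥0∞) ^ P.toReal := by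
            refine lintegral_mono_ae ((ae_restrict_mem measurableSet_Ioo).mono fun t ht => ?_)
            rw [lintegral_enorm_rpow_eq (v' t) hP0 hPtop]
            exact ENNReal.rpow_le_rpow (hLpS t ht) hr0.le
        _ < ∞ := by
            rw [setLIntegral_const]
            exact ENNReal.mul_lt_top (ENNReal.rpow_lt_top_of_nonneg hr0.le ENNReal.coe_ne_top)
              measure_Ioo_lt_top
    have hI : Tendsto (fun x₀ : ℝ³ => ∫⁻ z in Ioo 0 S ×ˢ ball x₀ R, ‖v' z.1 z.2‖ₑ ^ P.toReal)
        (cocompact ℝ³) (𝓝 0) :=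
      tendsto_setLIntegral_strip_ball (hvmeas.enorm.pow_const _) hfin R
    -- Step 2: Hölder on `(0,S) × B_R(x₀)`
    set V : ℝ≥0∞ := (volume (Ioo (0 : ℝ) S) * volume (ball (0 : ℝ³) R)) ^ (1 / 2 - 1 / P.toReal : ℝ)
      with hV
    have hVtop : V ≠ ∞ := ENNReal.rpow_ne_top_of_nonneg (by
      rw [sub_nonneg]
      exact one_div_le_one_div_of_le (by norm_num) hr2)
      (ENNReal.mul_lt_top measure_Ioo_lt_top measure_ball_lt_top).ne
    have hbound : ∀ x₀ : ℝ³, ∫⁻ z in Ioo 0 S ×ˢ ball x₀ R, ‖v' z.1 z.2‖ₑ ^ 2 ≤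
        ((∫⁻ z in Ioo 0 S ×ˢ ball x₀ R, ‖v' z.1 z.2‖ₑ ^ P.toReal) ^ (1 / P.toReal) * V) ^ 2 := by
      intro x₀
      have hm : AEStronglyMeasurable (uncurry v') (volume.restrict (Ioo 0 S ×ˢ ball x₀ R)) :=
        hvmeas.mono_measure (Measure.restrict_mono (Set.prod_mono Subset.rfl (subset_univ _)) le_rfl)
      have hH := lintegral_enorm_sq_le hm h2P
      rw [Measure.restrict_apply_univ, volume_Ioo_prod_ball', eLpNorm_eq_lintegral_rpow_enorm_toReal
        hP0 hPtop] at hH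
      exact hH
    have hmaj : Tendsto (fun x₀ : ℝ³ =>
        ((∫⁻ z in Ioo 0 S ×ˢ ball x₀ R, ‖v' z.1 z.2‖ₑ ^ P.toReal) ^ (1 / P.toReal) * V) ^ 2)
        (cocompact ℝ³) (𝓝 0) := by
      have h1 := ((ENNReal.continuous_rpow_const (y := (1 / P.toReal : ℝ))).tendsto 0).comp hI
      rw [ENNReal.zero_rpow_of_pos (by positivity)] at h1
      have h2 := ENNReal.Tendsto.mul_const h1 (Or.inr hVtop)
      rw [zero_mul] at h2
      have h3 := ((ENNReal.continuous_pow 2).tendsto 0).comp h2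
      rw [zero_pow two_ne_zero] at h3
      exact h3
    exact tendsto_of_tendsto_of_tendsto_of_le_of_le' tendsto_const_nhds hmaj
      (Eventually.of_forall fun _ => bot_le) (Eventually.of_forall hbound)

end Shift

/-! ### The global local Leray solution agrees with the classical solution below `T` -/

section Agreement

variable {T : ℝ} {v : ℝ → ℝ³ → ℝ³} {π : ℝ → ℝ³ → ℝ}

/-- **The datum `v(t₀)` is in `E²` and weakly divergence free** (`L^p ⊂ L²_uloc` with decay for
`2 ≤ p < ∞`, `memE2_of_memLp`; classical incompressibility). [cite: LemarieRieusset2016, Prop. 15.1 (proof)] -/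
theorem memE2_and_isWeaklyDivFree_datum (hv : IsClassicalNSSolutionOn (Ioo 0 T) 1 0 v π)
    {p : ℝ≥0} (hp : 3 ≤ p) (hvc : ContinuousInLpOn (Ico 0 T) p v) {t₀ : ℝ} (ht₀ : t₀ ∈ Ioo 0 T) :
    MemE2 (v t₀) ∧ IsWeaklyDivFree (v t₀) := by
  have h2p : (2 : ℝ≥0∞) ≤ (p : ℝ≥0∞) := by
    have : (3 : ℝ≥0∞) ≤ (p : ℝ≥0∞) := by exact_mod_cast hp
    exact le_trans (by norm_num) this
  refine ⟨memE2_of_memLp (hvc.1 t₀ ⟨ht₀.1.le, ht₀.2⟩) h2p ENNReal.coe_ne_top, ?_⟩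
  exact VectorCalculus.IsDivFree.isWeaklyDivFree_holds (hv.divFree t₀ ht₀)
    (contDiff_infty.1 (hv.contDiff_velocity ht₀) 1)

/-- **Weak–strong uniqueness below the blow-up time** (Lemarié-Rieusset 2016, Thm. 14.7 with
Thm. 14.8, as in the proof of Thm. 15.1 (C), p. 566). Let `(v, π)` be a classical solution of the
unforced Navier–Stokes system on `ℝ³ × (0, T)` with `v ∈ C([0,T); L^p)`, `3 ≤ p < ∞`, `t₀ ∈ (0, T)`,
and let `(w, π_w)` be a global local Leray solution from the datum `v(t₀)`. Then `w = v(· + t₀)`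
a.e. on `(0, T − t₀) × ℝ³`: on every slab `(0, S)`, `t₀ + S < T`, both are local Leray solutions
from `v(t₀)` (`isLocalLeraySolutionOn_shift_classical`) and `v(· + t₀)` is bounded, so the tree's
theorem `local_leray_weak_strong_uniqueness_holds` applies with `u₃ = v(· + t₀)`, `u₄ = 0`; the
slabs exhaust `(0, T − t₀)`. [cite: LemarieRieusset2016, Thm. 14.7 and Thm. 15.1 (C) (proof p. 566)] -/
theorem ae_eq_shift_of_isLocalLeraySolution (hv : IsClassicalNSSolutionOn (Ioo 0 T) 1 0 v π)
    {p : ℝ≥0} (hp : 3 ≤ p) (hvc : ContinuousInLpOn (Ico 0 T) p v) {t₀ : ℝ} (ht₀ : t₀ ∈ Ioo 0 T)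
    {w : ℝ → ℝ³ → ℝ³} {πw : ℝ → ℝ³ → ℝ} (hw : IsLocalLeraySolution 1 (v t₀) w πw) :
    (uncurry fun t => v (t + t₀)) =ᵐ[volume.restrict (Ioo 0 (T - t₀) ×ˢ (univ : Set ℝ³))]
      uncurry w := by
  set T' : ℝ := T - t₀ with hT'_def
  have hT' : 0 < T' := by rw [hT'_def]; linarith [ht₀.2]
  set v' : ℝ → ℝ³ → ℝ³ := fun t => v (t + t₀) with hv'_def
  obtain ⟨hE2, hdiv⟩ := memE2_and_isWeaklyDivFree_datum hv hp hvc ht₀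
  -- measurability of `v'` on the strip `(0, T') × ℝ³`
  have hvcont : ContinuousOn (uncurry v') (Ioo (-t₀) (T - t₀) ×ˢ univ) := by
    have h1 : ContinuousOn (uncurry v) (Ioo 0 T ×ˢ univ) := hv.smooth_velocity.continuousOn
    have h2 : Continuous fun q : ℝ × ℝ³ => ((q.1 + t₀, q.2) : ℝ × ℝ³) := by fun_prop
    refine h1.comp h2.continuousOn fun q hq => ?_
    have hq1 := (mem_prod.1 hq).1
    exact ⟨⟨by linarith [hq1.1], by linarith [hq1.2]⟩, mem_univ _⟩
  have hstripO : Ioo (0 : ℝ) T' ×ˢ (univ : Set ℝ³) ⊆ Ioo (-t₀) (T - t₀) ×ˢ univ :=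
    prod_mono (fun t ht => ⟨by linarith [ht.1, ht₀.1], ht.2⟩) Subset.rfl
  have hvmeas : AEStronglyMeasurable (uncurry v') (volume.restrict (Ioo (0 : ℝ) T' ×ˢ (univ : Set ℝ³))) :=
    (hvcont.mono hstripO).aestronglyMeasurable (measurableSet_Ioo.prod MeasurableSet.univ)
  -- agreement on every slab `(0, S) × ℝ³`, `S < T'`
  obtain ⟨ε₀, hε₀, hUniq⟩ := local_leray_weak_strong_uniqueness_holds
  have hagreeS : ∀ S : ℝ, 0 < S → S < T' →
      uncurry v' =ᵐ[volume.restrict (Ioo 0 S ×ˢ (univ : Set ℝ³))] uncurry w := by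
    intro S hS hST'
    have hSt : t₀ + S < T := by rw [hT'_def] at hST'; linarith
    obtain ⟨hloc, M, hM⟩ := isLocalLeraySolutionOn_shift_classical hv hp hvc ht₀ hS hSt
    have hvS : AEStronglyMeasurable (uncurry v') (volume.restrict (Ioo (0 : ℝ) S ×ˢ (univ : Set ℝ³))) :=
      hvmeas.mono_measure (Measure.restrict_mono (prod_mono (Ioo_subset_Ioo_right hST'.le) Subset.rfl) le_rfl)
    refine hUniq 1 S one_pos hS (v t₀) hE2 hdiv v' w (fun t => π (t + t₀)) πw hloc
      (hw.isLocalLeraySolutionOn S) v' 0 (Eventually.of_forall fun z => by simp [uncurry]) hvS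
      ⟨fun _ => M, ?_, (ae_restrict_mem measurableSet_Ioo).mono fun t ht => ?_⟩
      ⟨0, by positivity, Eventually.of_forall fun t => by simp⟩
    · exact integrableOn_const (hs := measure_Ioo_lt_top.ne)
    · rw [eLpNorm_exponent_top]
      exact eLpNormEssSup_le_of_ae_bound (Eventually.of_forall fun x => hM t ⟨ht.1.le, ht.2.le⟩ x)
  -- hence a.e. on `(0, T') × ℝ³`
  set Sn : ℕ → ℝ := fun n => T' - T' / (n + 2) with hSn
  have hSn_pos : ∀ n, 0 < Sn n := fun n => by
    rw [hSn]
    have h1 : T' / (n + 2) < T' := div_lt_self hT' (by norm_cast; omega)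
    linarith
  have hSn_lt : ∀ n, Sn n < T' := fun n => by
    rw [hSn]
    have h1 : 0 < T' / (n + 2) := by positivity
    linarith
  have hunion : Ioo (0 : ℝ) T' ×ˢ (univ : Set ℝ³) = ⋃ n : ℕ, Ioo (0 : ℝ) (Sn n) ×ˢ (univ : Set ℝ³) := by
    ext ⟨t, x⟩
    simp only [mem_prod, mem_Ioo, mem_univ, and_true, mem_iUnion]
    constructor
    · rintro ⟨ht0, htT⟩
      obtain ⟨n, hn⟩ := exists_nat_gt (T' / (T' - t))
      refine ⟨n, ht0, ?_⟩
      rw [hSn]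
      have hpos : 0 < T' - t := by linarith
      have h1 : T' / (T' - t) < n + 2 := by linarith
      have h2 : T' < (n + 2) * (T' - t) := by rwa [div_lt_iff₀ hpos] at h1
      have h3 : T' / (n + 2) < T' - t := by
        rw [div_lt_iff₀ (by positivity)]; linarith
      linarith
    · rintro ⟨n, ht0, htn⟩
      exact ⟨ht0, htn.trans (hSn_lt n)⟩
  rw [hunion]
  exact (ae_restrict_iUnion_iff _ _).2 fun n => hagreeS (Sn n) (hSn_pos n) (hSn_lt n)

end Agreement

/-! ### Local Leray solutions are in Albritton–Barker's class in parabolic balls -/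

section InBall

/-- **A global local Leray solution is a suitable weak solution of Albritton–Barker's class in
every parabolic ball inside its slab**: for `0 < ρ`, `ρ² ≤ T'`, `(w, π_w)` restricted to
`Q((T', z), ρ)` is suitable (restriction of the local notion), with the energy class from the
uniformly local energy bound at radius `max ρ √T'`, the gradient class from the uniformly local
gradient bound, and `π_w ∈ L^{3/2}(Q)` from `π_w ∈ L^{3/2}_loc` up to `t = 0`.
[cite: LemarieRieusset2016, Def. 14.1; AlbrittonBarker2019, Def. 2.1] -/
theorem isSuitableWeakSolutionInBall_of_isLocalLeraySolution {v₀ : ℝ³ → ℝ³} {w : ℝ → ℝ³ → ℝ³}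
    {πw : ℝ → ℝ³ → ℝ} (hw : IsLocalLeraySolution 1 v₀ w πw) {T' : ℝ} (z : ℝ³) {ρ : ℝ}
    (hρ : 0 < ρ) (hρT : ρ ^ 2 ≤ T') :
    IsSuitableWeakSolutionInBall ρ (T', z) w πw := by
  have hT' : 0 < T' := lt_of_lt_of_le (by positivity) hρT
  set R : ℝ := max ρ (Real.sqrt T') with hR
  have hR0 : 0 < R := hρ.trans_le (le_max_left _ _)
  have hρR : ρ ≤ R := le_max_left _ _
  have hR2 : T' ≤ R ^ 2 := by
    calc T' = Real.sqrt T' ^ 2 := (Real.sq_sqrt hT'.le).symm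
      _ ≤ R ^ 2 := pow_le_pow_left₀ (Real.sqrt_nonneg _) (le_max_right _ _) 2
  have hcyl : parabolicCylinder ρ ((T', z) : ℝ × ℝ³) = Ioo (T' - ρ ^ 2) T' ×ˢ ball z ρ := rfl
  have hle : (parabolicCylinderOpens ρ ((T', z) : ℝ × ℝ³) : Opens (ℝ × ℝ³)) ≤
      slab ℝ³ (Ioi 0) isOpen_Ioi := by
    intro q hq
    have hq' : q ∈ parabolicCylinder ρ ((T', z) : ℝ × ℝ³) := hq
    rw [mem_parabolicCylinder] at hq'
    have h0 : (0 : ℝ) < q.1 := by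
      have h1 := hq'.1.1
      simp only at h1
      linarith
    exact mem_slab.2 h0
  have hsubT : Ioo (T' - ρ ^ 2) T' ⊆ Ioo 0 (R ^ 2) := fun t ht =>
    ⟨by linarith [ht.1], lt_of_lt_of_le ht.2 hR2⟩
  have hsuit := hw.suitable.of_le hle
  refine ⟨hsuit, ?_, ?_, ?_⟩
  · -- the energy class
    obtain ⟨C, hC⟩ := hw.uniformLocalEnergy R hR0
    refine ⟨C, ?_⟩
    have hC' := ae_restrict_of_ae_restrict_of_subset hsubT hC
    filter_upwards [hC'] with t ht
    exact (lintegral_mono_set (ball_subset_ball hρR)).trans (ht z)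
  · -- the gradient class
    obtain ⟨G, hG, hGb⟩ := hw.uniformLocalGradient
    obtain ⟨C, hC⟩ := hGb R hR0
    refine ⟨G, hG.mono hle, ?_⟩
    rw [hcyl]
    exact lt_of_le_of_lt ((lintegral_mono_set (Set.prod_mono hsubT (ball_subset_ball hρR))).trans (hC z))
      ENNReal.coe_lt_top
  · -- the pressure class
    refine ⟨hsuit.distributional.2.2.1.aestronglyMeasurable, ?_⟩
    have h32 : ((3 : ℝ≥0∞) / 2).toReal = 3 / 2 := by
      rw [ENNReal.toReal_div]; norm_num
    have h32top : (3 : ℝ≥0∞) / 2 ≠ ⊤ := (ENNReal.div_lt_top (by simp) (by simp)).ne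
    rw [eLpNorm_eq_lintegral_rpow_enorm_toReal (by norm_num) h32top, h32]
    refine ENNReal.rpow_lt_top_of_nonneg (by positivity) (ne_of_lt ?_)
    show ∫⁻ q in parabolicCylinder ρ ((T', z) : ℝ × ℝ³), ‖uncurry πw q‖ₑ ^ (3 / 2 : ℝ) < ⊤
    rw [hcyl]
    have hsub : Ioo (T' - ρ ^ 2) T' ×ˢ ball z ρ ⊆ Ioo 0 T' ×ˢ closedBall z ρ :=
      prod_mono (fun t ht => ⟨by linarith [ht.1], ht.2⟩) ball_subset_closedBall
    exact lt_of_le_of_lt (lintegral_mono_set hsub) (hw.pressure T' hT' _ (isCompact_closedBall _ _))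

end InBall

/-! ### Time translation of Albritton–Barker's class -/

section TimeShift

/-- The time translate `(s, y) ↦ w(s − t₀, y)` in the tree's rescaling vocabulary:
`1 • stPull 1 1 (−t₀) 0 w`. [folklore] -/
theorem one_smul_stPull_neg {F : Type*} [NormedAddCommGroup F] [NormedSpace ℝ F] (t₀ : ℝ)
    (w : ℝ → ℝ³ → F) : ((1 : ℝ) • stPull 1 1 (-t₀) (0 : ℝ³) w) = fun s y => w (s - t₀) y := by
  funext s y
  rw [smul_stPull_apply, one_smul, one_mul, one_smul, zero_add, neg_add_eq_sub]

/-- The same with the factor `1²` (pressure) . [folklore] -/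
theorem one_sq_smul_stPull_neg {F : Type*} [NormedAddCommGroup F] [NormedSpace ℝ F] (t₀ : ℝ)
    (w : ℝ → ℝ³ → F) : (((1 : ℝ) ^ 2) • stPull 1 1 (-t₀) (0 : ℝ³) w) = fun s y => w (s - t₀) y := by
  rw [one_pow]; exact one_smul_stPull_neg t₀ w

/-- The preimage of the parabolic ball `Q((T' + t₀, z), ρ)`... more precisely: the preimage of
`Q((T', z), ρ)` under `(s, y) ↦ (s − t₀, y)` is `Q((T' + t₀, z), ρ)`. [folklore] -/
theorem stAffine_neg_preimage_parabolicCylinder (t₀ T' ρ : ℝ) (z : ℝ³) :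
    stAffine 1 1 (-t₀) (0 : ℝ³) ⁻¹' parabolicCylinder ρ ((T', z) : ℝ × ℝ³) =
      parabolicCylinder ρ ((T' + t₀, z) : ℝ × ℝ³) := by
  ext ⟨s, y⟩
  simp only [mem_preimage, stAffine_apply, one_mul, one_smul, zero_add, mem_parabolicCylinder]
  constructor
  · rintro ⟨⟨h1, h2⟩, h3⟩; exact ⟨⟨by linarith, by linarith⟩, h3⟩
  · rintro ⟨⟨h1, h2⟩, h3⟩; exact ⟨⟨by linarith, by linarith⟩, h3⟩

/-- The `Opens` form of `stAffine_neg_preimage_parabolicCylinder`. [folklore] -/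
theorem stPreimage_neg_parabolicCylinderOpens (t₀ T' ρ : ℝ) (z : ℝ³) :
    stPreimage 1 1 (-t₀) (0 : ℝ³) (parabolicCylinderOpens ρ ((T', z) : ℝ × ℝ³)) =
      parabolicCylinderOpens ρ ((T' + t₀, z) : ℝ × ℝ³) :=
  Opens.ext (stAffine_neg_preimage_parabolicCylinder t₀ T' ρ z)

/-- **Time translation of an a.e.-in-time statement on an interval.** [folklore] -/
theorem ae_restrict_Ioo_comp_sub {P : ℝ → Prop} {a b : ℝ} (t₀ : ℝ)
    (h : ∀ᵐ t ∂(volume.restrict (Ioo a b)), P t) :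
    ∀ᵐ s ∂(volume.restrict (Ioo (a + t₀) (b + t₀))), P (s - t₀) := by
  rw [ae_restrict_iff' measurableSet_Ioo] at h ⊢
  have h2 := (measurePreserving_sub_right (volume : Measure ℝ) t₀).quasiMeasurePreserving.ae h
  filter_upwards [h2] with s hs hsI
  exact hs ⟨by linarith [hsI.1], by linarith [hsI.2]⟩

set_option maxHeartbeats 800000 in
/-- **Time translation of Albritton–Barker's class** (Def. 2.1 is translation invariant; the
local notion and the weak gradient by the tree's covariance `IsSuitableWeakSolutionOn.stRescale`,
`HasWeakSpatialGradientOn.stRescale` with unit factors, the integrability classes by the change of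
variables `setLIntegral_frobeniusNormSq_stRescale`, `setLIntegral_enorm_rpow_stRescale`): if
`(w, P)` is in the class in `Q((T', z), ρ)` then `(w(· − t₀), P(· − t₀))` is in the class in
`Q((T' + t₀, z), ρ)`. [cite: AlbrittonBarker2019, Def. 2.1; CaffarelliKohnNirenberg1982, §2] -/
theorem isSuitableWeakSolutionInBall_timeShift {w : ℝ → ℝ³ → ℝ³} {P : ℝ → ℝ³ → ℝ} {T' ρ : ℝ}
    {z : ℝ³} (h : IsSuitableWeakSolutionInBall ρ ((T', z) : ℝ × ℝ³) w P) (t₀ : ℝ) :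
    IsSuitableWeakSolutionInBall ρ ((T' + t₀, z) : ℝ × ℝ³) (fun s y => w (s - t₀) y)
      (fun s y => P (s - t₀) y) := by
  obtain ⟨hsuit, ⟨C, hC⟩, ⟨G, hG, hG2⟩, hp⟩ := h
  have hpre := stPreimage_neg_parabolicCylinderOpens t₀ T' ρ z
  have hpre' := stAffine_neg_preimage_parabolicCylinder t₀ T' ρ z
  -- the local notion
  have hsuit1 : IsSuitableWeakSolutionOn (parabolicCylinderOpens ρ ((T' + t₀, z) : ℝ × ℝ³)) 1 0
      (fun s y => w (s - t₀) y) (fun s y => P (s - t₀) y) := by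
    have h0 := hsuit.stRescale one_pos one_pos (show (1 : ℝ) = 1 * 1 by norm_num) (-t₀) (0 : ℝ³)
    have hvisc : (1 : ℝ) * 1 / 1 = 1 := by norm_num
    have hforce : (((1 : ℝ) ^ 2 * 1) • stPull 1 1 (-t₀) (0 : ℝ³) (0 : ℝ → ℝ³ → ℝ³)) = 0 := by
      funext s y; simp [stPull]
    rw [hvisc, hforce, hpre, one_smul_stPull_neg, one_sq_smul_stPull_neg] at h0
    exact h0
  refine ⟨hsuit1, ?_, ?_, ?_⟩
  · -- the energy class
    refine ⟨C, ?_⟩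
    have h1 := ae_restrict_Ioo_comp_sub t₀ hC
    have e1 : T' - ρ ^ 2 + t₀ = T' + t₀ - ρ ^ 2 := by ring
    rw [e1] at h1
    exact h1
  · -- the gradient class
    have eG : ∀ q : ℝ × ℝ³, (((1 : ℝ) * 1) • stPull 1 1 (-t₀) (0 : ℝ³) G) q.1 q.2 = G (q.1 - t₀) q.2 := by
      intro q
      change ((1 : ℝ) * 1) • G (-t₀ + 1 * q.1) ((0 : ℝ³) + (1 : ℝ) • q.2) = G (q.1 - t₀) q.2
      rw [one_mul, one_smul, one_mul, one_smul, zero_add, neg_add_eq_sub]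
    refine ⟨fun s y => G (s - t₀) y, ?_, ?_⟩
    · have h1 := hG.stRescale 1 one_pos one_pos (-t₀) (0 : ℝ³)
      rw [hpre, one_smul_stPull_neg] at h1
      have e : (((1 : ℝ) * 1) • stPull 1 1 (-t₀) (0 : ℝ³) G) = fun s y => G (s - t₀) y := by
        funext s y; exact eG (s, y)
      rw [e] at h1
      exact h1
    · have h1 := setLIntegral_frobeniusNormSq_stRescale one_pos one_pos (-t₀) (0 : ℝ³) ((1 : ℝ) * 1) G
        (parabolicCylinder ρ ((T', z) : ℝ × ℝ³))
      rw [hpre'] at h1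
      simp_rw [eG] at h1
      show ∫⁻ q in parabolicCylinder ρ ((T' + t₀, z) : ℝ × ℝ³),
          ENNReal.ofReal (frobeniusNormSq (G (q.1 - t₀) q.2)) < ⊤
      rw [h1]
      exact ENNReal.mul_lt_top (ENNReal.mul_lt_top ENNReal.ofReal_lt_top ENNReal.ofReal_lt_top) hG2
  · -- the pressure class
    refine ⟨hsuit1.distributional.2.2.1.aestronglyMeasurable, ?_⟩
    have h32 : ((3 : ℝ≥0∞) / 2).toReal = 3 / 2 := by
      rw [ENNReal.toReal_div]; norm_num
    have h32top : (3 : ℝ≥0∞) / 2 ≠ ⊤ := (ENNReal.div_lt_top (by simp) (by simp)).ne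
    rw [eLpNorm_eq_lintegral_rpow_enorm_toReal (by norm_num) h32top, h32]
    refine ENNReal.rpow_lt_top_of_nonneg (by positivity) (ne_of_lt ?_)
    have h1 := setLIntegral_enorm_rpow_stRescale one_pos one_pos (-t₀) (0 : ℝ³) ((1 : ℝ) ^ 2) P
      (parabolicCylinder ρ ((T', z) : ℝ × ℝ³)) (r := 3 / 2) (by norm_num)
    have eP : ∀ q : ℝ × ℝ³, (((1 : ℝ) ^ 2) • stPull 1 1 (-t₀) (0 : ℝ³) P) q.1 q.2 = P (q.1 - t₀) q.2 := by
      intro q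
      change ((1 : ℝ) ^ 2) • P (-t₀ + 1 * q.1) ((0 : ℝ³) + (1 : ℝ) • q.2) = P (q.1 - t₀) q.2
      rw [one_pow, one_smul, one_mul, one_smul, zero_add, neg_add_eq_sub]
    rw [hpre'] at h1
    simp_rw [eP] at h1
    show ∫⁻ q in parabolicCylinder ρ ((T' + t₀, z) : ℝ × ℝ³), ‖P (q.1 - t₀) q.2‖ₑ ^ (3 / 2 : ℝ) < ⊤
    rw [h1]
    have hp2 := hp.2
    rw [eLpNorm_eq_lintegral_rpow_enorm_toReal (by norm_num) h32top, h32] at hp2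
    have hfin : ∫⁻ q in parabolicCylinder ρ ((T', z) : ℝ × ℝ³), ‖uncurry P q‖ₑ ^ (3 / 2 : ℝ) < ⊤ :=
      lt_top_iff_ne_top.2 fun htop => by
        rw [htop, ENNReal.top_rpow_of_pos (by norm_num)] at hp2
        exact lt_irrefl _ hp2
    exact ENNReal.mul_lt_top (ENNReal.mul_lt_top (by simp) ENNReal.ofReal_lt_top) hfin

end TimeShift

/-! ### `h₂` from the local Leray existence theorem, and Chae's Theorem 1.5 -/

section Assembly

variable {T : ℝ} {v : ℝ → ℝ³ → ℝ³} {π : ℝ → ℝ³ → ℝ}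

/-- **Transfer of the a.e. agreement to a parabolic ball below `T`**: if `v(· + t₀) = w` a.e. on
`(0, T − t₀) × ℝ³` and `ρ² ≤ T − t₀`, then `w(· − t₀) = v` a.e. on `Q((T, z), ρ)` (the time
translation preserves Lebesgue measure on `ℝ × ℝ³`). [folklore] -/
theorem ae_eq_on_parabolicCylinder_of_shift {t₀ : ℝ} {w : ℝ → ℝ³ → ℝ³}
    (hagree : (uncurry fun t => v (t + t₀)) =ᵐ[volume.restrict (Ioo 0 (T - t₀) ×ˢ (univ : Set ℝ³))]
      uncurry w) (z : ℝ³) {ρ : ℝ} (hρT : ρ ^ 2 ≤ T - t₀) :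
    (uncurry fun s y => w (s - t₀) y) =ᵐ[volume.restrict (parabolicCylinder ρ ((T, z) : ℝ × ℝ³))]
      uncurry v := by
  have hmp : MeasurePreserving (Prod.map (fun x : ℝ => x - t₀) (id : ℝ³ → ℝ³))
      ((volume : Measure ℝ).prod (volume : Measure ℝ³)) ((volume : Measure ℝ).prod (volume : Measure ℝ³)) :=
    (measurePreserving_sub_right (volume : Measure ℝ) t₀).prod (MeasurePreserving.id (volume : Measure ℝ³))
  have h1 : ∀ᵐ q ∂((volume : Measure ℝ).prod (volume : Measure ℝ³)),
      q ∈ Ioo 0 (T - t₀) ×ˢ (univ : Set ℝ³) → uncurry (fun t => v (t + t₀)) q = uncurry w q :=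
    (ae_restrict_iff' (measurableSet_Ioo.prod MeasurableSet.univ)).1 hagree
  have h2 : ∀ᵐ q ∂(volume : Measure (ℝ × ℝ³)),
      ((q.1 - t₀, q.2) : ℝ × ℝ³) ∈ Ioo 0 (T - t₀) ×ˢ (univ : Set ℝ³) →
        uncurry (fun t => v (t + t₀)) ((q.1 - t₀, q.2) : ℝ × ℝ³) = uncurry w ((q.1 - t₀, q.2) : ℝ × ℝ³) :=
    hmp.quasiMeasurePreserving.ae h1
  have hcyl : parabolicCylinder ρ ((T, z) : ℝ × ℝ³) = Ioo (T - ρ ^ 2) T ×ˢ ball z ρ := rfl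
  rw [hcyl, Filter.EventuallyEq, ae_restrict_iff' (measurableSet_Ioo.prod measurableSet_ball)]
  filter_upwards [h2] with q hq hqQ
  have hq1 : (q.1 - t₀, q.2) ∈ Ioo 0 (T - t₀) ×ˢ (univ : Set ℝ³) := by
    have ht := (mem_prod.1 hqQ).1
    refine ⟨⟨?_, ?_⟩, mem_univ _⟩
    · show 0 < q.1 - t₀
      linarith [ht.1, hρT, sq_nonneg ρ]
    · show q.1 - t₀ < T - t₀
      linarith [ht.2]
  have e := hq hq1
  simp only [uncurry, sub_add_cancel] at e
  simp only [uncurry]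
  exact e.symm

/-- **The suitable representative up to the blow-up time, from the local Leray existence
theorem** — the input `h₂` of `chae2007_asymptoticallySelfSimilar_local_of_suitableRepresentative`:
for a classical solution `(v, π)` of the unforced Navier–Stokes system on `ℝ³ × (0, T)` with
`v ∈ C([0,T); L^p)`, `3 ≤ p < ∞`, and every `z`, the global local Leray solution `w` from the datum
`v(T/2)` (the tree's named fact `localLeraySolution_exists_of_memE2`, Lemarié-Rieusset 2016,
Thm. 14.8), translated in time by `T/2`, is a suitable weak solution of Albritton–Barker's class in
`Q((T, z), √(T/2))` equal to `v` a.e. there (weak–strong uniqueness below `T`,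
`ae_eq_shift_of_isLocalLeraySolution`). [cite: LemarieRieusset2016, Thm. 14.7, Thm. 14.8 and Thm. 15.1 (C) (proof p. 566); Chae2007, proof of Thm 1.5 (arXiv p. 8)] -/
theorem suitableRepresentative_of_localLerayExistence (hE : localLeraySolution_exists_of_memE2) :
    ∀ ⦃T : ℝ⦄, 0 < T → ∀ ⦃p : ℝ≥0⦄, 3 ≤ p → ∀ ⦃v : ℝ → ℝ³ → ℝ³⦄ ⦃π : ℝ → ℝ³ → ℝ⦄,
      IsClassicalNSSolutionOn (Ioo 0 T) 1 0 v π → ContinuousInLpOn (Ico 0 T) p v → ∀ z : ℝ³,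
      ∃ ρ : ℝ, 0 < ρ ∧ ρ ^ 2 ≤ T ∧ ∃ (u : ℝ → ℝ³ → ℝ³) (P : ℝ → ℝ³ → ℝ),
        IsSuitableWeakSolutionInBall ρ (T, z) u P ∧
        uncurry u =ᵐ[volume.restrict (parabolicCylinder ρ (T, z))] uncurry v := by
  intro T hT p hp v π hv hvc z
  set t₀ : ℝ := T / 2 with ht₀_def
  have ht₀ : t₀ ∈ Ioo 0 T := ⟨by rw [ht₀_def]; positivity, by rw [ht₀_def]; linarith⟩
  have hTt₀ : T - t₀ = T / 2 := by rw [ht₀_def]; ring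
  obtain ⟨hE2, hdiv⟩ := memE2_and_isWeaklyDivFree_datum hv hp hvc ht₀
  obtain ⟨w, πw, hw⟩ := hE (v t₀) hE2 hdiv
  have hagree := ae_eq_shift_of_isLocalLeraySolution hv hp hvc ht₀ hw
  set ρ : ℝ := Real.sqrt (T / 2) with hρ_def
  have hρ0 : 0 < ρ := Real.sqrt_pos.2 (by positivity)
  have hρ2 : ρ ^ 2 = T / 2 := Real.sq_sqrt (by positivity)
  have hball : IsSuitableWeakSolutionInBall ρ ((T - t₀, z) : ℝ × ℝ³) w πw :=
    isSuitableWeakSolutionInBall_of_isLocalLeraySolution hw z hρ0 (by rw [hρ2, hTt₀])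
  have hshift := isSuitableWeakSolutionInBall_timeShift hball t₀
  rw [sub_add_cancel] at hshift
  refine ⟨ρ, hρ0, by rw [hρ2]; linarith, fun s y => w (s - t₀) y, fun s y => πw (s - t₀) y, hshift, ?_⟩
  exact ae_eq_on_parabolicCylinder_of_shift hagree z (by rw [hρ2, hTt₀])

end Assembly

end ChaeLocalLeray

/-- **Chae's Theorem 1.5 from the local Leray existence theorem** (D. Chae, Math. Ann. 338 (2007),
Thm 1.5 = arXiv:math/0604234 pp. 4–5, proof pp. 7–8): the named fact
`chae2007_asymptoticallySelfSimilar_local` follows from the tree's named fact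
`localLeraySolution_exists_of_memE2` (Lemarié-Rieusset 2016, Thm. 14.8: weakly divergence-free
`E²` data launch global local Leray solutions) alone — the blow-up limit, the vanishing of the
profile in `L^p` for all `3 ≤ p < ∞` (Nečas–Růžička–Šverák / Tsai), the `ε`-regularity endgame
(Gustafson–Kang–Tsai's criterion) being proved in the companions, and the suitable representative
reaching the blow-up time coming from the local Leray theory
(`ChaeLocalLeray.suitableRepresentative_of_localLerayExistence`: existence **E** with the tree's
weak–strong uniqueness theorem). [cite: Chae2007, Thm 1.5 (proof, arXiv pp. 7–8); LemarieRieusset2016, Thm. 14.7, Thm. 14.8] -/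
theorem chae2007_asymptoticallySelfSimilar_local_of_localLerayExistence
    (hE : localLeraySolution_exists_of_memE2) : chae2007_asymptoticallySelfSimilar_local :=
  chae2007_asymptoticallySelfSimilar_local_of_suitableRepresentative
    (ChaeLocalLeray.suitableRepresentative_of_localLerayExistence hE)

end Literature.Analysis.FluidPDE

end
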